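import Summits.CriticalPhenomena.PercolationContinuityZ3.Theorems.PercNearOneGluingNoHeavyLowerTailSahiTangentCumulationEdge

/-!
# `NoHeavyLowerTail` (crux stmt-CriticalPhenomena-4575), Sahi programme: the all-orders contraction inequality on the **CONE OF CYLINDER PAIRS** —
# slots whose top/bottom sections are `Σ_j a_j·1_{C(t_j)}` / `Σ_j a_j κ_j·1_{C(b_j)}` (`a_j ≥ 0`, `κ_j ∈ [0,1]`, `t_j ⊆ b_j`), every order, every product measure

Support file (Sahi cell, seat `prim-sahi-p1`, generation 50; `--supports stmt-CriticalPhenomena-4575`).  Pure proofs, NO definitions, no `sorry`,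
standard axioms.

THE RESULTS (`μ = bernoulliWeight q`, two-layer weight `B_s ⊗ μ` on `Bool × Set ι`, `cSlot t b κ (ε,ω) = ε ? 1_{C(t)} : κ·1_{C(b)}`).
* `sahiE_coin_cSlot_mixed_ge`: MIXED families of cylinder pairs (`κ_l = 1`) and top-only cylinders (`κ_l = 0`): `s·E_n^{μ}(1_{C(t_l)}) ≤ E_n^{B_s⊗μ}(cSlot t_l b_l κ_l)`.
  With a top-only slot present the FULL mixed moment of every other slot vanishes on the bottom layer, so EVERY defect coordinate is erasable
  (`SahiTangent.sahiE_update_le_of_moments`) and the induction on `Σ|b_l ∖ t_l|` ends at a scalar/vertex family (`sahiE_coin_scalar_ge`); without one it is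
  the pair theorem `sahiE_coin_cSlot_pairs_ge`.
* `sahiE_coin_cSlot_ge`: damped bottoms, `κ ∈ [0,1]^n` (slot linearity, `cSlot_lin`).
* `sahiE_coin_pairCone_ge`: slots `F_l = Σ_{j∈T} a_{lj}·cSlot t_{lj} b_{lj} κ_{lj}` (`a ≥ 0`): `s·E_n^{μ}(Σ_j a_{lj} 1_{C(t_{lj})}) ≤ E_n^{B_s⊗μ}(F_l)` — the contraction
  inequality on the whole convex cone generated by elementary cylinder pairs and top-only cylinders (finite-sum slot linearity `sahiE_update_finset_sum`).
  In section language: all slots `(g¹, g⁰) = (Σ a_j 1_{C(t_j)}, Σ a_jκ_j 1_{C(b_j)})` — "decomposable cumulation pairs".  Together with `sahiE_cumulation_edge_ge`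
  (pairs with `g¹ − g⁰ ∈ 𝒞`) these are the proved sub-cones of CONJECTURE T_n(𝒞-pairs) (gen-50 memo §5: all `g⁰ ≤ g¹` in Sahi's cone `𝒞`).
Nothing conjectural is asserted. [this work]
-/

namespace Summit.CriticalPhenomena.PercolationContinuityZ3.Theorems.SahiTangentCyl

open Finset Function Literature.Combinatorics.Sahi2008
open Literature.Probability.Percolation.DecisionTree (ind ind_of_mem ind_of_not_mem ind_nonneg)
open scoped BigOperators

noncomputable section

variable {ι : Type*} [DecidableEq ι] [Fintype ι]

/-- **MIXED FAMILIES of cylinder pairs and top-only cylinders.**  `t_l ⊆ b_l`, `κ_l ∈ {0,1}`: `s·E_n^{μ}(1_{C(t_l)}) ≤ E_n^{B_s⊗μ}(cSlot t_l b_l κ_l)`. [this work] -/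
theorem sahiE_coin_cSlot_mixed_ge (q : ι → unitInterval) {s : ℝ} (hs0 : 0 ≤ s) (hs1 : s ≤ 1) :
    ∀ (n : ℕ) (t b : Fin n → Finset ι) (κ : Fin n → ℝ), (∀ l, t l ⊆ b l) → (∀ l, κ l = 0 ∨ κ l = 1) →
      s * sahiE (bernoulliWeight q) n (fun l (ω : Set ι) => ind {ω : Set ι | (t l : Set ι) ⊆ ω} ω) ≤
        sahiE (fun z : Bool × Set ι => if z.1 then s * bernoulliWeight q z.2 else (1 - s) * bernoulliWeight q z.2) n
          (fun l => cSlot (t l) (b l) (κ l)) := by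
  set ν : Bool × Set ι → ℝ := fun z => if z.1 then s * bernoulliWeight q z.2 else (1 - s) * bernoulliWeight q z.2 with hν
  have hq0 : ∀ i, 0 ≤ ((q i : ℝ)) := fun i => (q i).2.1
  have hq1 : ∀ i, ((q i : ℝ)) ≤ 1 := fun i => (q i).2.2
  intro n
  induction n using Nat.strong_induction_on with
  | _ n ihn =>
    suffices h : ∀ (N : ℕ) (t b : Fin n → Finset ι) (κ : Fin n → ℝ), ∑ l, (b l \ t l).card = N → (∀ l, t l ⊆ b l) → (∀ l, κ l = 0 ∨ κ l = 1) →
        s * sahiE (bernoulliWeight q) n (fun l (ω : Set ι) => ind {ω : Set ι | (t l : Set ι) ⊆ ω} ω) ≤ sahiE ν n (fun l => cSlot (t l) (b l) (κ l)) from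
      fun t b κ htb hκ => h _ t b κ rfl htb hκ
    intro N
    induction N using Nat.strong_induction_on with
    | _ N ihN =>
      intro t b κ hN htb hκ
      by_cases hall : ∀ l, κ l = 1
      · -- only pair slots: the pair theorem
        have e : (fun l => cSlot (t l) (b l) (κ l)) = fun l => cSlot (t l) (b l) 1 := by
          funext l; rw [hall l]
        rw [e]; exact sahiE_coin_cSlot_pairs_ge q hs0 hs1 n t b htb
      · push Not at hall
        obtain ⟨l₀, hl₀⟩ := hall
        have hκ₀ : κ l₀ = 0 := (hκ l₀).resolve_right hl₀
        by_cases hfr : ∀ l, b l \ t l = ∅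
        · -- no defects: a scalar family
          have e : (fun l => cSlot (t l) (b l) (κ l)) = fun l => cSlot (t l) (t l) (κ l) := by
            funext l
            have hb : b l = t l := Finset.Subset.antisymm (fun x hx => by
              by_contra hxt; have : x ∈ b l \ t l := Finset.mem_sdiff.2 ⟨hx, hxt⟩; rw [hfr l] at this; exact absurd this (by simp)) (htb l)
            rw [hb]
          rw [e]
          exact sahiE_coin_scalar_ge q hs0 hs1 t κ (fun l => by rcases hκ l with h | h <;> simp [h])
            (fun l => by rcases hκ l with h | h <;> simp [h])
        · push Not at hfr
          obtain ⟨k, hk⟩ := hfr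
          obtain ⟨e, hek⟩ := hk
          have hekb : e ∈ b k := (Finset.mem_sdiff.1 hek).1
          have hekt : e ∉ t k := (Finset.mem_sdiff.1 hek).2
          set b' : Fin n → Finset ι := update b k ((b k).erase e) with hb'
          have htb' : ∀ l, t l ⊆ b' l := by
            intro l
            by_cases hl : l = k
            · subst hl; rw [hb', update_self]
              exact fun x hx => Finset.mem_erase.2 ⟨fun h => hekt (h ▸ hx), htb l hx⟩
            · rw [hb', update_of_ne hl]; exact htb l
          have hN' : ∑ l, (b' l \ t l).card < N := by
            rw [← hN]
            apply Finset.sum_lt_sum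
            · intro l _
              by_cases hl : l = k
              · subst hl; rw [hb', update_self]
                exact Finset.card_le_card (sdiff_subset_sdiff (erase_subset e (b l)) subset_rfl)
              · rw [hb', update_of_ne hl]
            · refine ⟨k, mem_univ k, ?_⟩
              rw [hb', update_self]
              apply Finset.card_lt_card
              refine ⟨sdiff_subset_sdiff (erase_subset e (b k)) subset_rfl, fun hcon => ?_⟩
              have := Finset.mem_sdiff.1 (hcon hek)
              exact (Finset.notMem_erase e (b k)) this.1
          have step1 := ihN _ hN' t b' κ rfl htb' hκ
          refine le_trans step1 ?_
          -- compare the two families, which differ only in slot `k`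
          by_cases hκk : κ k = 0
          · -- a top-only slot does not see its bottom
            have e2 : (fun l => cSlot (t l) (b' l) (κ l)) = fun l => cSlot (t l) (b l) (κ l) := by
              funext l
              by_cases hl : l = k
              · subst hl; rw [hκk, cSlot_zero, cSlot_zero]
              · rw [hb', update_of_ne hl]
            rw [e2]
          · have hκk1 : κ k = 1 := (hκ k).resolve_left hκk
            have hkl₀ : k ≠ l₀ := fun h => hκk (h ▸ hκ₀)
            have enew : update (fun l => cSlot (t l) (b l) (κ l)) k (cSlot (t k) ((b k).erase e) 1) = fun l => cSlot (t l) (b' l) (κ l) := by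
              funext l
              by_cases h : l = k
              · subst h; rw [update_self, hb', update_self, hκk1]
              · rw [update_of_ne h, hb', update_of_ne h]
            have eold : update (fun l => cSlot (t l) (b l) (κ l)) k (cSlot (t k) (b k) 1) = fun l => cSlot (t l) (b l) (κ l) := by
              funext l
              by_cases h : l = k
              · subst h; rw [update_self, hκk1]
              · rw [update_of_ne h]
            have hKnn : ∀ S : Finset (Fin n), 0 ≤ ∏ l ∈ S, κ l :=
              fun S => Finset.prod_nonneg fun l _ => by rcases hκ l with h | h <;> simp [h]
            have key : sahiE ν n (update (fun l => cSlot (t l) (b l) (κ l)) k (cSlot (t k) ((b k).erase e) 1)) ≤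
                sahiE ν n (update (fun l => cSlot (t l) (b l) (κ l)) k (cSlot (t k) (b k) 1)) := by
              refine SahiTangent.sahiE_update_le_of_moments ν n _ k (cSlot (t k) (b k) 1) (cSlot (t k) ((b k).erase e) 1) ?_ ?_ ?_
              · intro S hS
                rw [prod_cSlot, cSlot_mul, cSlot_mul, hν, ex_cSlot, ex_cSlot]
                have hanti : cylMass (fun i => (q i : ℝ)) (b k ∪ S.biUnion b) ≤ cylMass (fun i => (q i : ℝ)) ((b k).erase e ∪ S.biUnion b) :=
                  cylMass_anti hq0 hq1 (union_subset_union (erase_subset e (b k)) subset_rfl)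
                have h1s : 0 ≤ 1 - s := sub_nonneg.2 hs1
                nlinarith [mul_le_mul_of_nonneg_left hanti (mul_nonneg h1s (hKnn S))]
              · rw [prod_cSlot, cSlot_mul, cSlot_mul, hν, ex_cSlot, ex_cSlot]
                have hz : ∏ l ∈ univ.erase k, κ l = 0 :=
                  Finset.prod_eq_zero (Finset.mem_erase.2 ⟨hkl₀.symm, mem_univ l₀⟩) hκ₀
                rw [hz]; ring
              · intro m φ hφ hφk
                have hm : m < n := lt_of_injective_of_forall_ne hφ hφk
                have h := ihn m hm (fun i => t (φ i)) (fun i => b (φ i)) (fun i => κ (φ i)) (fun i => htb (φ i)) (fun i => hκ (φ i))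
                exact le_trans (mul_nonneg hs0 (sahiE_cyl_nonneg q fun i => t (φ i))) h
            rw [enew, eold] at key
            exact key

/-- **DAMPED BOTTOMS**: `t_l ⊆ b_l`, `κ ∈ [0,1]^n`: `s·E_n^{μ}(1_{C(t_l)}) ≤ E_n^{B_s⊗μ}(cSlot t_l b_l κ_l)` (interpolation between `κ_l ∈ {0,1}` by slot
linearity). [this work] -/
theorem sahiE_coin_cSlot_ge (q : ι → unitInterval) {s : ℝ} (hs0 : 0 ≤ s) (hs1 : s ≤ 1) {n : ℕ} (t b : Fin n → Finset ι) (htb : ∀ l, t l ⊆ b l)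
    (κ : Fin n → ℝ) (hκ0 : ∀ l, 0 ≤ κ l) (hκ1 : ∀ l, κ l ≤ 1) :
    s * sahiE (bernoulliWeight q) n (fun l (ω : Set ι) => ind {ω : Set ι | (t l : Set ι) ⊆ ω} ω) ≤
      sahiE (fun z : Bool × Set ι => if z.1 then s * bernoulliWeight q z.2 else (1 - s) * bernoulliWeight q z.2) n
        (fun l => cSlot (t l) (b l) (κ l)) := by
  suffices h : ∀ A : Finset (Fin n), ∀ κ : Fin n → ℝ, (∀ l, l ∉ A → κ l = 0 ∨ κ l = 1) → (∀ l, 0 ≤ κ l) → (∀ l, κ l ≤ 1) →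
      s * sahiE (bernoulliWeight q) n (fun l (ω : Set ι) => ind {ω : Set ι | (t l : Set ι) ⊆ ω} ω) ≤
        sahiE (fun z : Bool × Set ι => if z.1 then s * bernoulliWeight q z.2 else (1 - s) * bernoulliWeight q z.2) n
          (fun l => cSlot (t l) (b l) (κ l)) from
    h univ κ (fun l hl => absurd (mem_univ l) hl) hκ0 hκ1
  intro A
  induction A using Finset.induction_on with
  | empty =>
    intro κ hbin _ _
    exact sahiE_coin_cSlot_mixed_ge q hs0 hs1 n t b κ htb fun l => hbin l (Finset.notMem_empty l)
  | insert l₀ A hl₀ ih =>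
    intro κ hbin hκ0 hκ1
    have eF : (fun l => cSlot (t l) (b l) (κ l)) = update (fun l => cSlot (t l) (b l) (κ l)) l₀ (cSlot (t l₀) (b l₀) (κ l₀)) := by
      rw [eq_update_self_iff]
    rw [eF, cSlot_lin, sahiE_update_lin]
    have e1 : update (fun l => cSlot (t l) (b l) (κ l)) l₀ (cSlot (t l₀) (b l₀) 1) = fun l => cSlot (t l) (b l) (update κ l₀ 1 l) := by
      rw [update_cSlot_family]; simp
    have e0 : update (fun l => cSlot (t l) (b l) (κ l)) l₀ (cSlot (t l₀) (b l₀) 0) = fun l => cSlot (t l) (b l) (update κ l₀ 0 l) := by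
      rw [update_cSlot_family]; simp
    rw [e1, e0]
    have hb1 : ∀ l, l ∉ A → update κ l₀ 1 l = 0 ∨ update κ l₀ 1 l = 1 := by
      intro l hl
      by_cases h : l = l₀
      · subst h; simp
      · rw [update_of_ne h]; exact hbin l (by simp [h, hl])
    have hb0 : ∀ l, l ∉ A → update κ l₀ 0 l = 0 ∨ update κ l₀ 0 l = 1 := by
      intro l hl
      by_cases h : l = l₀
      · subst h; simp
      · rw [update_of_ne h]; exact hbin l (by simp [h, hl])
    have h1 := ih (update κ l₀ 1) hb1
      (fun l => by by_cases h : l = l₀ <;> simp [h, update_of_ne, hκ0])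
      (fun l => by by_cases h : l = l₀ <;> simp [h, update_of_ne, hκ1])
    have h0 := ih (update κ l₀ 0) hb0
      (fun l => by by_cases h : l = l₀ <;> simp [h, update_of_ne, hκ0])
      (fun l => by by_cases h : l = l₀ <;> simp [h, update_of_ne, hκ1])
    have hk0 := hκ0 l₀
    have hk1 : 0 ≤ 1 - κ l₀ := sub_nonneg.2 (hκ1 l₀)
    nlinarith [mul_le_mul_of_nonneg_left h1 hk0, mul_le_mul_of_nonneg_left h0 hk1]

/-- **THE CONTRACTION INEQUALITY ON THE CONE OF CYLINDER PAIRS, EVERY ORDER.**  Slots `F_l = Σ_{j∈T} a_{lj}·cSlot t_{lj} b_{lj} κ_{lj}` with `a ≥ 0`,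
`t_{lj} ⊆ b_{lj}`, `κ ∈ [0,1]` (sections `g_l¹ = Σ_j a_{lj} 1_{C(t_{lj})}`, `g_l⁰ = Σ_j a_{lj}κ_{lj} 1_{C(b_{lj})}`):  `s·E_n^{μ}(g¹) ≤ E_n^{B_s⊗μ}(F)`. [this work] -/
theorem sahiE_coin_pairCone_ge {J : Type*} (q : ι → unitInterval) {s : ℝ} (hs0 : 0 ≤ s) (hs1 : s ≤ 1) {n : ℕ} (T : Finset J)
    (a : Fin n → J → ℝ) (ha : ∀ l j, 0 ≤ a l j) (t b : Fin n → J → Finset ι) (htb : ∀ l j, t l j ⊆ b l j)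
    (κ : Fin n → J → ℝ) (hκ0 : ∀ l j, 0 ≤ κ l j) (hκ1 : ∀ l j, κ l j ≤ 1) :
    s * sahiE (bernoulliWeight q) n (fun l (ω : Set ι) => ∑ j ∈ T, a l j * ind {ω : Set ι | (t l j : Set ι) ⊆ ω} ω) ≤
      sahiE (fun z : Bool × Set ι => if z.1 then s * bernoulliWeight q z.2 else (1 - s) * bernoulliWeight q z.2) n
        (fun l (z : Bool × Set ι) => ∑ j ∈ T, a l j * cSlot (t l j) (b l j) (κ l j) z) := by
  set ν : Bool × Set ι → ℝ := fun z => if z.1 then s * bernoulliWeight q z.2 else (1 - s) * bernoulliWeight q z.2 with hν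
  -- mixed families: sum slots on `A`, single slots `(t' l, b' l, κ' l)` off `A`; induction on `A`
  suffices h : ∀ (A : Finset (Fin n)) (t' b' : Fin n → Finset ι) (κ' : Fin n → ℝ), (∀ l, t' l ⊆ b' l) → (∀ l, 0 ≤ κ' l) → (∀ l, κ' l ≤ 1) →
      s * sahiE (bernoulliWeight q) n (fun l (ω : Set ι) =>
          if l ∈ A then ∑ j ∈ T, a l j * ind {ω : Set ι | (t l j : Set ι) ⊆ ω} ω else ind {ω : Set ι | (t' l : Set ι) ⊆ ω} ω) ≤
        sahiE ν n (fun l (z : Bool × Set ι) =>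
          if l ∈ A then ∑ j ∈ T, a l j * cSlot (t l j) (b l j) (κ l j) z else cSlot (t' l) (b' l) (κ' l) z) by
    have h' := h univ (fun _ => ∅) (fun _ => ∅) (fun _ => 0) (fun _ => subset_rfl) (fun _ => le_rfl) (fun _ => zero_le_one)
    simpa only [Finset.mem_univ, if_true] using h'
  intro A
  induction A using Finset.induction_on with
  | empty =>
    intro t' b' κ' htb' hκ0' hκ1'
    simp only [Finset.notMem_empty, if_false]
    exact sahiE_coin_cSlot_ge q hs0 hs1 t' b' htb' κ' hκ0' hκ1'
  | insert l₀ A hl₀ ih =>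
    intro t' b' κ' htb' hκ0' hκ1'
    set Gt : Fin n → Set ι → ℝ := fun l ω =>
      if l ∈ A then ∑ j ∈ T, a l j * ind {ω : Set ι | (t l j : Set ι) ⊆ ω} ω else ind {ω : Set ι | (t' l : Set ι) ⊆ ω} ω with hGt
    set G : Fin n → Bool × Set ι → ℝ := fun l z =>
      if l ∈ A then ∑ j ∈ T, a l j * cSlot (t l j) (b l j) (κ l j) z else cSlot (t' l) (b' l) (κ' l) z with hG
    have eGt : (fun l (ω : Set ι) =>
          if l ∈ insert l₀ A then ∑ j ∈ T, a l j * ind {ω : Set ι | (t l j : Set ι) ⊆ ω} ω else ind {ω : Set ι | (t' l : Set ι) ⊆ ω} ω)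
        = update Gt l₀ (fun ω => ∑ j ∈ T, a l₀ j * (fun j (ω : Set ι) => ind {ω : Set ι | (t l₀ j : Set ι) ⊆ ω} ω) j ω) := by
      funext l ω
      by_cases h : l = l₀
      · subst h; simp
      · rw [update_of_ne h]; simp [hGt, h]
    have eG : (fun l (z : Bool × Set ι) =>
          if l ∈ insert l₀ A then ∑ j ∈ T, a l j * cSlot (t l j) (b l j) (κ l j) z else cSlot (t' l) (b' l) (κ' l) z)
        = update G l₀ (fun z => ∑ j ∈ T, a l₀ j * (fun j => cSlot (t l₀ j) (b l₀ j) (κ l₀ j)) j z) := by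
      funext l z
      by_cases h : l = l₀
      · subst h; simp
      · rw [update_of_ne h]; simp [hG, h]
    rw [eGt, eG, sahiE_update_finset_sum, sahiE_update_finset_sum, Finset.mul_sum]
    refine Finset.sum_le_sum fun j _ => ?_
    rw [← mul_assoc, mul_comm s (a l₀ j), mul_assoc]
    refine mul_le_mul_of_nonneg_left ?_ (ha l₀ j)
    have e1 : update Gt l₀ ((fun j (ω : Set ι) => ind {ω : Set ι | (t l₀ j : Set ι) ⊆ ω} ω) j)
        = fun l (ω : Set ι) =>
          if l ∈ A then ∑ j ∈ T, a l j * ind {ω : Set ι | (t l j : Set ι) ⊆ ω} ω else ind {ω : Set ι | (update t' l₀ (t l₀ j) l : Set ι) ⊆ ω} ω := by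
      funext l ω
      by_cases h : l = l₀
      · subst h; simp [hl₀]
      · rw [update_of_ne h, update_of_ne h]
    have e2 : update G l₀ ((fun j => cSlot (t l₀ j) (b l₀ j) (κ l₀ j)) j)
        = fun l (z : Bool × Set ι) =>
          if l ∈ A then ∑ j ∈ T, a l j * cSlot (t l j) (b l j) (κ l j) z
          else cSlot (update t' l₀ (t l₀ j) l) (update b' l₀ (b l₀ j) l) (update κ' l₀ (κ l₀ j) l) z := by
      funext l z
      by_cases h : l = l₀
      · subst h; simp [hl₀]
      · rw [update_of_ne h, update_of_ne h, update_of_ne h, update_of_ne h]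
    rw [e1, e2]
    refine ih (update t' l₀ (t l₀ j)) (update b' l₀ (b l₀ j)) (update κ' l₀ (κ l₀ j)) ?_ ?_ ?_
    · intro l; by_cases h : l = l₀
      · subst h; simp [htb]
      · simp [update_of_ne h, htb']
    · intro l; by_cases h : l = l₀
      · subst h; simp [hκ0]
      · simp [update_of_ne h, hκ0']
    · intro l; by_cases h : l = l₀
      · subst h; simp [hκ1]
      · simp [update_of_ne h, hκ1']

end

end Summit.CriticalPhenomena.PercolationContinuityZ3.Theorems.SahiTangentCyl
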